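import Literature.IUT.HodgeArakelov.EtaleThetaDataOfSettingPhiRangeAut
import Literature.IUT.HodgeArakelov.EtaleThetaDataOfSettingGaloisUnits
import Literature.AnabelianGeometry.EtaleTheta.Discharge.Sec2DtpYThetaAbelian
import Literature.AnabelianGeometry.EtaleTheta.BarDeltaOfSetting

/-!
# [IUTchII] Prop 3.4 (i) / Cor 1.11 (b), binder `hgal`: the commutator pairing `φ[·, B] : Δ^tp_{Y̲̲} → l·Δ_Θ` and its transport
# under a topological automorphism of `Π^tp_{X̲̲}` lying over `Inn(τ)|_{G_K}` («HCYC-FROM-HGAL», file 1 of 2: group theory)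

S. Mochizuki, *Inter-universal Teichmüller theory II*, kurims manuscript (Dec. 2020): Prop 3.4 (i) pp. 91–92, Cor 1.11 (b)
p. 49 [cite: Mochizuki2012, Prop 3.4 (i) p.92] — claim key DISPUTED (D-0012).  Refereed inputs ([EtTh] = S. Mochizuki, Publ.
RIMS **45** (2009)): §1 p. 12 («`Δ^Θ_X = Δ_X/[Δ_X,[Δ_X,Δ_X]]`», «`Δ_Θ` the image of `∧² Δ^ell_X`», «the natural surjection
`Π^tp_X ↠ Z` … up to `Aut(Z) = {±1}`»), Prop 2.2 (iii) p. 37, Def 2.7 p. 41 («`Π^tp_{X̲̲}/Π^tp_{Ÿ̲̲} ≅ (l·Z) × μ₂`»), Prop 2.12 (i)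
p. 45, Cor 2.18 (i) p. 60 (= FACT F-0620, consumed BY NAME through `mem_PiYdd_iff_of_cor218_i` in file 2).  abc-iut cell,
layer L6, WAVE-5 seat abc-iut-w5-d169 (gen 5; holder lineage of node IUTchII:Prop3.4(i)); GAP-LEDGER G-w5d169-3 (binder `hgal`
= (HGAL) ∧ (HCYC) of `EtaleLevels.prop34i_multiradiallyDefined_saturated_of{Galois,Core,Cor28i}`; D-row 2026-08-26T11:4xZ:
«(HCYC) ⟸ (HGAL)» route) and G-w5d145-2 (abc-iut-w5-d145 `compatible_of_galois`).

PROOF-ONLY (no definition, no `Prop`-valued fact, nothing restated).  For the genuine `φ : Π^tp_{X̲̲} → (Π^tp_X)^Θ` of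
`EtaleThetaDataOfSetting.lean`, a geometric `Z`-generator `B ∈ Δ^tp_{X̲̲}` (`toLZ B = 1`) and `Δ^tp_{Y̲̲} := Δ^tp_X ∩ Π^tp_Y ∩
Π^tp_{X̲̲}` (`aug = 1`, `toLZ = 1`):
* §0–§1 the COMMUTATOR PAIRING `n ↦ φ[n, B] := φ(n B n⁻¹ B⁻¹) ∈ l·Δ_Θ` on `Δ^tp_{Y̲̲}`: multiplicative (`phi_commutator_mul`,
  class-two structure of `(Δ^tp_X)^Θ`, root fields `ker_toEll`/`ker_thetaToEll_central`), `Π^tp_{X̲̲}`-EQUIVARIANT for the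
  conjugation actions (`phi_commutator_conj`; uses «`(Δ^tp_Y)^Θ` abelian» = abc-iut-L2's `ThetaSetting.dtpYTheta_comm`,
  PROVED from `IsEtThOrigin`), values in `φ(Π^tp_{X̲̲}) ∩ Δ_Θ = l·Δ_Θ` (`map_toTheta_Huu`);
* §2 for a topological automorphism `α` of `Π^tp_{X̲̲}` with (HGAL) `aug ∘ α = Inn(τ) ∘ aug` and `α(Π^tp_{Ÿ̲̲}) = Π^tp_{Ÿ̲̲}`:
  `α(Δ^tp_{Y̲̲}) ⊆ Δ^tp_{Y̲̲}` (`toLZ_alpha_eq_one`, via `[Π^tp_{Y̲̲} : Π^tp_{Ÿ̲̲}] = 2` and torsion-freeness of `ℤ`) and THE TEMPERED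
  SIGN `d(α) = ±1` with `α B = B^d · y`, `y ∈ Δ^tp_{Y̲̲}` (`exists_sign`: `α` acts on `Π^tp_{X̲̲}/Π^tp_{Y̲̲} ≅ ℤ`, `Aut(ℤ) = {±1}`);
* §3 the TRANSPORT IDENTITIES `φ(α[n, B]) = φ[α n, B]^d` (`phi_alpha_commutator`) and, for the Kummer cocycle
  `k(g) := [g, B]` of `B` and ANY `g ∈ Π^tp_{X̲̲}`, `φ(α[k g, B]) = φ[k(α g), B] · (φ(α g) φ[y,B] φ(α g)⁻¹ φ[y,B]⁻¹)^d`
  (`phi_alpha_kummer`; the sign enters only as `d² = 1`).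
File 2 (`EtaleThetaDataOfSettingCyclotomeKummerRelation.lean`) reads these through `red_M : l·Δ_Θ ↠ μ_M`.  Nothing here asserts
anything of [IUTchII] or [EtTh]; no side taken on [IUTchIII] Cor 3.12; typed ≠ proved for the binders.
-/

noncomputable section

open Topology

namespace Literature.IUT.HodgeArakelov

namespace EtaleThetaDataOfSetting

open Literature.AnabelianGeometry.EtaleTheta Literature.AnabelianGeometry.SemiGraphs

variable {p : ℕ} [Fact p.Prime] {D : Literature.AnabelianGeometry.EtaleTheta.ThetaSetting p}
  {E : D.EtaleThetaData} {l : ℕ} (C : E.DoubleUnderline l)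

/-! ### 0. Bookkeeping: `φ`, `aug`, `Δ^tp_{X̲̲}`, `Π^tp_{Y̲̲}` inside `Π^tp_{X̲̲}` -/

/-- `φ(g) = (g)^Θ`. [cite: MochizukiEtTh2009, §1 p.12] -/
theorem phi_apply (g : Pi C) : phi C g = D.toTheta (g : D.PiTemp) := rfl

/-- `aug(g) = 1` iff `g ∈ Δ^tp_X`. [cite: MochizukiEtTh2009, §1 p.12] -/
theorem mem_deltaTemp_of_aug_eq_one {g : Pi C} (hg : aug C g = 1) : (g : D.PiTemp) ∈ D.DeltaTemp := hg

/-- For `g ∈ Δ^tp_{X̲̲}`: `φ(g) ∈ (Δ^tp_X)^Θ`. [cite: MochizukiEtTh2009, §1 p.12] -/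
theorem phi_mem_dtpTheta {g : Pi C} (hg : aug C g = 1) : phi C g ∈ D.DtpTheta :=
  ⟨(g : D.PiTemp), mem_deltaTemp_of_aug_eq_one C hg, rfl⟩

/-- `toLZ g = 1` iff `g ∈ Π^tp_Y` (`Π^tp_{Y̲̲} = Π^tp_Y ∩ Π^tp_{X̲̲} = Ker(Π^tp_{X̲̲} ↠ ℤ)`). [cite: MochizukiEtTh2009, Def 2.13 (i) p.47] -/
theorem toLZ_eq_one_iff (g : Pi C) : C.toLZ g = 1 ↔ (g : D.PiTemp) ∈ D.GtpY := by
  rw [← MonoidHom.mem_ker, C.toLZ_ker, Subgroup.mem_subgroupOf]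

/-- For `g ∈ Δ^tp_{Y̲̲} = Δ^tp_X ∩ Π^tp_Y ∩ Π^tp_{X̲̲}`: `φ(g) ∈ (Δ^tp_Y)^Θ`. [cite: MochizukiEtTh2009, §1 p.12] -/
theorem phi_mem_dtpYTheta {g : Pi C} (hg : aug C g = 1) (hgY : C.toLZ g = 1) : phi C g ∈ D.DtpYTheta :=
  ⟨(g : D.PiTemp), ⟨(toLZ_eq_one_iff C g).1 hgY, mem_deltaTemp_of_aug_eq_one C hg⟩, rfl⟩

/-- Commutators of `Δ^tp_{X̲̲}` map to `Δ_Θ`. [cite: MochizukiEtTh2009, §1 p.12] -/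
theorem phi_commutator_mem_deltaTheta {a b : Pi C} (ha : aug C a = 1) (hb : aug C b = 1) :
    phi C (a * b * a⁻¹ * b⁻¹) ∈ D.DeltaTheta := by
  simp only [map_mul, map_inv]
  exact D.commutator_mem_deltaTheta (phi_mem_dtpTheta C ha) (phi_mem_dtpTheta C hb)

/-- Commutators of `Δ^tp_{X̲̲}` map to `φ(Π^tp_{X̲̲}) ∩ Δ_Θ = l·Δ_Θ` (Prop. 2.12 (i) `map_toTheta_Huu`).
[cite: MochizukiEtTh2009, Prop 2.12 (i) p.45] -/
theorem phi_commutator_mem_lDeltaTheta {a b : Pi C} (ha : aug C a = 1) (hb : aug C b = 1) :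
    phi C (a * b * a⁻¹ * b⁻¹) ∈ D.lDeltaTheta l := by
  rw [← C.map_toTheta_Huu]
  exact ⟨⟨_, (a * b * a⁻¹ * b⁻¹).2, rfl⟩, phi_commutator_mem_deltaTheta C ha hb⟩

/-- **`(Δ^tp_Y)^Θ` is abelian** at an origin (abc-iut-L2-t2/… `dtpYTheta_comm`, PROVED from `IsEtThOrigin`): commutators
of `Δ^tp_{Y̲̲}` die in `(Π^tp_X)^Θ`. [cite: MochizukiEtTh2009, §1 p.12] -/
theorem phi_commutator_eq_one_of_origin (hO : D.IsEtThOrigin) {a b : Pi C} (ha : aug C a = 1) (haY : C.toLZ a = 1)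
    (hb : aug C b = 1) (hbY : C.toLZ b = 1) : phi C (a * b * a⁻¹ * b⁻¹) = 1 := by
  have h := D.dtpYTheta_comm hO _ (phi_mem_dtpYTheta C ha haY) _ (phi_mem_dtpYTheta C hb hbY)
  simp only [map_mul, map_inv]
  rw [h]; group

/-! ### 1. The commutator pairing `c_B(n) := φ[n, B]` on `Δ^tp_{Y̲̲}`: a `Π^tp_{X̲̲}`-equivariant homomorphism -/

section Pairing

variable (hO : D.IsEtThOrigin) {B : Pi C} (hB : aug C B = 1)

include hB in
/-- **Multiplicativity**: `φ[n n', B] = φ[n, B] · φ[n', B]` for `n, n' ∈ Δ^tp_{Y̲̲}` (class-two structure: `Δ_Θ` central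
in `(Δ^tp_X)^Θ`, `(Δ^tp_Y)^Θ` abelian). [cite: MochizukiEtTh2009, §1 p.12] -/
theorem phi_commutator_mul {n n' : Pi C} (hn : aug C n = 1) (hn' : aug C n' = 1) :
    phi C (n * n' * B * (n * n')⁻¹ * B⁻¹) = phi C (n * B * n⁻¹ * B⁻¹) * phi C (n' * B * n'⁻¹ * B⁻¹) := by
  -- `[n n', B] = n [n', B] n⁻¹ · [n, B]` and `n` commutes with `[n', B] ∈ Δ_Θ`
  have hid : n * n' * B * (n * n')⁻¹ * B⁻¹ = n * (n' * B * n'⁻¹ * B⁻¹) * n⁻¹ * (n * B * n⁻¹ * B⁻¹) := by group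
  have hc : phi C (n' * B * n'⁻¹ * B⁻¹) ∈ D.DeltaTheta := phi_commutator_mem_deltaTheta C hn' hB
  have hcomm : phi C (n' * B * n'⁻¹ * B⁻¹) * phi C n = phi C n * phi C (n' * B * n'⁻¹ * B⁻¹) :=
    D.deltaTheta_comm_dtpTheta hc (phi_mem_dtpTheta C hn)
  have hcomm2 : phi C (n * B * n⁻¹ * B⁻¹) * phi C (n' * B * n'⁻¹ * B⁻¹) =
      phi C (n' * B * n'⁻¹ * B⁻¹) * phi C (n * B * n⁻¹ * B⁻¹) :=
    D.ker_thetaToEll_comm _ (phi_commutator_mem_deltaTheta C hn hB) _ hc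
  rw [hid, map_mul, map_mul, map_mul, map_inv, ← hcomm, mul_assoc (phi C _) (phi C n), mul_inv_cancel, mul_one,
    hcomm2]

include hB in
/-- **Inverses**: `φ[n⁻¹, B] = φ[n, B]⁻¹` for `n ∈ Δ^tp_{X̲̲}`. [cite: MochizukiEtTh2009, §1 p.12] -/
theorem phi_commutator_inv {n : Pi C} (hn : aug C n = 1) :
    phi C (n⁻¹ * B * n⁻¹⁻¹ * B⁻¹) = (phi C (n * B * n⁻¹ * B⁻¹))⁻¹ := by
  have h := phi_commutator_mul C hB (n := n⁻¹) (n' := n) (by rw [map_inv, hn, inv_one]) hn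
  rw [eq_inv_iff_mul_eq_one, ← h]
  simp only [inv_mul_cancel, one_mul, inv_one, mul_one, mul_inv_cancel, map_one]

include hO hB in
/-- **`Π^tp_{X̲̲}`-equivariance**: `φ[x n x⁻¹, B] = φ(x) · φ[n, B] · φ(x)⁻¹` for `n ∈ Δ^tp_{Y̲̲}` and ANY `x ∈ Π^tp_{X̲̲}`
(`x⁻¹ B x ∈ B · Δ^tp_{Y̲̲}` and `(Δ^tp_Y)^Θ` is abelian). [cite: MochizukiEtTh2009, §1 p.12] -/
theorem phi_commutator_conj (hBY : C.toLZ B = Multiplicative.ofAdd 1) (x : Pi C) {n : Pi C} (hn : aug C n = 1)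
    (hnY : C.toLZ n = 1) :
    phi C ((x * n * x⁻¹) * B * (x * n * x⁻¹)⁻¹ * B⁻¹) = phi C x * phi C (n * B * n⁻¹ * B⁻¹) * (phi C x)⁻¹ := by
  -- `m := B⁻¹ x⁻¹ B x ∈ Δ^tp_{Y̲̲}`
  have hm : aug C (B⁻¹ * x⁻¹ * B * x) = 1 := by
    simp only [map_mul, map_inv, hB, inv_one, one_mul]
    rw [mul_one, inv_mul_cancel]
  have hmY : C.toLZ (B⁻¹ * x⁻¹ * B * x) = 1 := by
    simp only [map_mul, map_inv, hBY]
    rw [mul_comm (Multiplicative.ofAdd (1:ℤ))⁻¹, mul_assoc, mul_assoc, ← mul_assoc (Multiplicative.ofAdd (1:ℤ))⁻¹,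
      inv_mul_cancel, one_mul, inv_mul_cancel]
  -- `[x n x⁻¹, B] = x [n, B m] x⁻¹` and `[n, B m] = [n, B] · B [n, m] B⁻¹` with `φ[n, m] = 1`
  have hid : (x * n * x⁻¹) * B * (x * n * x⁻¹)⁻¹ * B⁻¹ =
      x * ((n * B * n⁻¹ * B⁻¹) * (B * (n * (B⁻¹ * x⁻¹ * B * x) * n⁻¹ * (B⁻¹ * x⁻¹ * B * x)⁻¹) * B⁻¹)) * x⁻¹ := by
    group
  rw [hid]
  simp only [map_mul, map_inv]
  have h1 : phi C (n * (B⁻¹ * x⁻¹ * B * x) * n⁻¹ * (B⁻¹ * x⁻¹ * B * x)⁻¹) = 1 :=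
    phi_commutator_eq_one_of_origin C hO hn hnY hm hmY
  simp only [map_mul, map_inv] at h1
  rw [h1]
  group

end Pairing

/-! ### 2. A topological automorphism `α` of `Π^tp_{X̲̲}` over `Inn(τ)|_{G_K}`: stability of `Δ^tp_{Y̲̲}`, the sign `d = ±1` -/

section Alpha

variable (hS : D.Sec2Hyps) (α : (Pi C) ≃ₜ* (Pi C)) (τ : GQp p)
  (hgal : ∀ x : Pi C, aug C (α x) = τ * aug C x * τ⁻¹)
  (hYdd : ∀ x : Pi C, x ∈ PiYdd C ↔ α x ∈ PiYdd C)

include hgal in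
/-- (HGAL) ⇒ `α(Δ^tp_{X̲̲}) ⊆ Δ^tp_{X̲̲}`. [cite: Mochizuki2012, Prop 3.4 (i) p.92] -/
theorem aug_alpha_eq_one {n : Pi C} (hn : aug C n = 1) : aug C (α n) = 1 := by
  rw [hgal, hn, mul_one, mul_inv_cancel]

include hS in
/-- `[Π^tp_{Y̲̲} : Π^tp_{Ÿ̲̲}] = 2`: squares of `Π^tp_{Y̲̲}` lie in `Π^tp_{Ÿ̲̲}`. [cite: MochizukiEtTh2009, Def 2.7 p.41] -/
theorem mul_self_mem_PiYdd {n : Pi C} (hnY : C.toLZ n = 1) : n * n ∈ PiYdd C := by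
  have hidx : (D.GtpYdd.subgroupOf (C.Huu ⊓ D.GtpY)).index = 2 := C.relIndex_GtpYdd_inf hS
  have hnY' : (n : D.PiTemp) ∈ C.Huu ⊓ D.GtpY := ⟨n.2, (toLZ_eq_one_iff C n).1 hnY⟩
  have h := Subgroup.mul_self_mem_of_index_two hidx ⟨(n : D.PiTemp), hnY'⟩
  rw [Subgroup.mem_subgroupOf] at h
  change (n * n : Pi C) ∈ C.GtpYdduu.subgroupOf C.Huu
  rw [Subgroup.mem_subgroupOf]
  exact ⟨h, (n * n).2⟩

include hS hYdd in
/-- F-0620 (`α(Π^tp_{Ÿ̲̲}) = Π^tp_{Ÿ̲̲}`) ⇒ `α(Π^tp_{Y̲̲}) ⊆ Π^tp_{Y̲̲}` (`Π^tp_{Y̲̲} = {x | x² ∈ Π^tp_{Ÿ̲̲}}`, `ℤ` torsion-free).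
[cite: MochizukiEtTh2009, Cor 2.18 (i) p.60] -/
theorem toLZ_alpha_eq_one {n : Pi C} (hnY : C.toLZ n = 1) : C.toLZ (α n) = 1 := by
  have h2 : α n * α n ∈ PiYdd C := by rw [← map_mul]; exact (hYdd _).1 (mul_self_mem_PiYdd C hS hnY)
  have h3 : C.toLZ (α n * α n) = 1 := by
    rw [toLZ_eq_one_iff]
    have : ((α n * α n : Pi C) : D.PiTemp) ∈ C.GtpYdduu := (Subgroup.mem_subgroupOf).1 h2
    exact D.GtpYdd_le_GtpY this.1
  rw [map_mul] at h3
  have h4 : Multiplicative.toAdd (C.toLZ (α n)) + Multiplicative.toAdd (C.toLZ (α n)) = 0 := by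
    rw [← toAdd_mul, h3, toAdd_one]
  have h5 : Multiplicative.toAdd (C.toLZ (α n)) = 0 := by omega
  exact Multiplicative.toAdd.injective h5

include hS hYdd in
/-- **The sign `d(α) = ±1`** (`α` acts on `Π^tp_{X̲̲}/Π^tp_{Y̲̲} ≅ ℤ`; `Aut(ℤ) = {±1}` — THE TEMPERED INPUT): for `B` with
`toLZ B = 1`, `α B = B^d · y` with `d ∈ {1, −1}` and `y ∈ Π^tp_{Y̲̲}`. [cite: MochizukiEtTh2009, §1 p.12] -/
theorem exists_sign {B : Pi C} (hBY : C.toLZ B = Multiplicative.ofAdd 1) :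
    ∃ d : ℤ, (d = 1 ∨ d = -1) ∧ C.toLZ (α B) = Multiplicative.ofAdd d := by
  set d : ℤ := Multiplicative.toAdd (C.toLZ (α B)) with hd
  have hfac : ∀ x : Pi C, C.toLZ (α x) = Multiplicative.ofAdd (Multiplicative.toAdd (C.toLZ x) * d) := by
    intro x
    set m : ℤ := Multiplicative.toAdd (C.toLZ x) with hm
    have hn : C.toLZ (B ^ (-m) * x) = 1 := by
      rw [map_mul, map_zpow, hBY, ← ofAdd_zsmul, smul_eq_mul, mul_one, hm, ofAdd_neg, ofAdd_toAdd,
        inv_mul_cancel]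
    have hx : x = B ^ m * (B ^ (-m) * x) := by group
    rw [hx, map_mul, map_mul, toLZ_alpha_eq_one C hS α hYdd hn, mul_one, map_zpow, map_zpow,
      ← ofAdd_toAdd (C.toLZ (α B)), ← hd, ← ofAdd_zsmul, smul_eq_mul]
  obtain ⟨x, hx⟩ := α.surjective (Classical.choose (C.toLZ_surjective (Multiplicative.ofAdd 1)))
  have hx1 : C.toLZ (α x) = Multiplicative.ofAdd 1 := by
    rw [hx]; exact Classical.choose_spec (C.toLZ_surjective (Multiplicative.ofAdd 1))
  rw [hfac] at hx1
  have hmul : Multiplicative.toAdd (C.toLZ x) * d = 1 := Multiplicative.ofAdd.injective hx1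
  refine ⟨d, ?_, by rw [hd, ofAdd_toAdd]⟩
  rcases Int.isUnit_iff.1 (IsUnit.of_mul_eq_one _ (by rw [mul_comm]; exact hmul)) with h | h
  · exact Or.inl h
  · exact Or.inr h

include hgal in
/-- The correction term `y := B^{-d} · α B` lies in `Δ^tp_{Y̲̲}`. [cite: MochizukiEtTh2009, §1 p.12] -/
theorem corr_mem {B : Pi C} (hB : aug C B = 1) (hBY : C.toLZ B = Multiplicative.ofAdd 1) {d : ℤ}
    (hd : C.toLZ (α B) = Multiplicative.ofAdd d) :
    aug C (B ^ (-d) * α B) = 1 ∧ C.toLZ (B ^ (-d) * α B) = 1 := by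
  refine ⟨?_, ?_⟩
  · rw [map_mul, map_zpow, hB, one_zpow, one_mul, aug_alpha_eq_one C α τ hgal hB]
  · rw [map_mul, map_zpow, hBY, hd, ← ofAdd_zsmul, smul_eq_mul, mul_one, ofAdd_neg, inv_mul_cancel]

end Alpha

/-! ### 3. Transport of the pairing under `α`: `ᾱ(φ[n, B]) = φ[α n, B]^d` and the `q`-Kummer relation in `(Π^tp_X)^Θ` -/

section Transport

variable (hO : D.IsEtThOrigin) {B : Pi C} (hB : aug C B = 1) (hBY : C.toLZ B = Multiplicative.ofAdd 1)

/-- `toLZ` computations in `ℤ`: an element with additive image `0` has `toLZ = 1` (plumbing). [folklore] -/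
private theorem toLZ_eq_one_of_toAdd {w : Pi C} (h : Multiplicative.toAdd (C.toLZ w) = 0) : C.toLZ w = 1 :=
  Multiplicative.toAdd.injective (by rw [h, toAdd_one])

include hO hB in
/-- Conjugating `n ∈ Δ^tp_{Y̲̲}` by `x ∈ Δ^tp_{X̲̲}` does not change `φ[n, B]` (`Δ_Θ` is central in `(Δ^tp_X)^Θ`).
[cite: MochizukiEtTh2009, §1 p.12] -/
theorem phi_commutator_conj_delta (hBY : C.toLZ B = Multiplicative.ofAdd 1) {x : Pi C} (hx : aug C x = 1) {n : Pi C}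
    (hn : aug C n = 1) (hnY : C.toLZ n = 1) :
    phi C ((x * n * x⁻¹) * B * (x * n * x⁻¹)⁻¹ * B⁻¹) = phi C (n * B * n⁻¹ * B⁻¹) := by
  rw [phi_commutator_conj C hO hB hBY x hn hnY]
  have hc : phi C (n * B * n⁻¹ * B⁻¹) * phi C x = phi C x * phi C (n * B * n⁻¹ * B⁻¹) :=
    D.deltaTheta_comm_dtpTheta (phi_commutator_mem_deltaTheta C hn hB) (phi_mem_dtpTheta C hx)
  rw [← hc, mul_assoc, mul_inv_cancel, mul_one]

include hO hB hBY in
/-- `φ[h n h⁻¹ n⁻¹, B] = φ(h) φ[n, B] φ(h)⁻¹ · φ[n, B]⁻¹` for `n ∈ Δ^tp_{Y̲̲}` and ANY `h ∈ Π^tp_{X̲̲}` — the coboundary of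
`φ[n, B]` under the conjugation action. [cite: MochizukiEtTh2009, §1 p.12] -/
theorem phi_commutator_hconj (h : Pi C) {n : Pi C} (hn : aug C n = 1) (hnY : C.toLZ n = 1) :
    phi C ((h * n * h⁻¹ * n⁻¹) * B * (h * n * h⁻¹ * n⁻¹)⁻¹ * B⁻¹) =
      phi C h * phi C (n * B * n⁻¹ * B⁻¹) * (phi C h)⁻¹ * (phi C (n * B * n⁻¹ * B⁻¹))⁻¹ := by
  have hhn : aug C (h * n * h⁻¹) = 1 := by rw [map_mul, map_mul, map_inv, hn, mul_one, mul_inv_cancel]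
  have hninv : aug C n⁻¹ = 1 := by rw [map_inv, hn, inv_one]
  rw [phi_commutator_mul C hB hhn hninv, phi_commutator_conj C hO hB hBY h hn hnY, phi_commutator_inv C hB hn]

include hO hB hBY in
/-- The sign bookkeeping: `φ[h B^d h⁻¹ B^{-d}, B] = φ[h B h⁻¹ B⁻¹, B]^d` for `d = ±1` and ANY `h ∈ Π^tp_{X̲̲}`.
[cite: MochizukiEtTh2009, §1 p.12] -/
theorem phi_commutator_sign (h : Pi C) {d : ℤ} (hd1 : d = 1 ∨ d = -1) :
    phi C ((h * B ^ d * h⁻¹ * B ^ (-d)) * B * (h * B ^ d * h⁻¹ * B ^ (-d))⁻¹ * B⁻¹) =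
      (phi C ((h * B * h⁻¹ * B⁻¹) * B * (h * B * h⁻¹ * B⁻¹)⁻¹ * B⁻¹)) ^ d := by
  have hK : aug C (h * B * h⁻¹ * B⁻¹) = 1 := by
    simp only [map_mul, map_inv, hB, inv_one, mul_one, mul_inv_cancel]
  have hKY : C.toLZ (h * B * h⁻¹ * B⁻¹) = 1 := by
    apply toLZ_eq_one_of_toAdd C
    simp only [map_mul, map_inv, hBY, toAdd_mul, toAdd_inv, toAdd_ofAdd]; ring
  have hBinv : aug C B⁻¹ = 1 := by rw [map_inv, hB, inv_one]
  rcases hd1 with rfl | rfl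
  · have hid : h * B ^ (1:ℤ) * h⁻¹ * B ^ (-(1:ℤ)) = h * B * h⁻¹ * B⁻¹ := by group
    rw [hid, zpow_one]
  · have hid : h * B ^ (-1:ℤ) * h⁻¹ * B ^ (-(-1:ℤ)) = B⁻¹ * (h * B * h⁻¹ * B⁻¹)⁻¹ * B⁻¹⁻¹ := by group
    have hKinv : aug C (h * B * h⁻¹ * B⁻¹)⁻¹ = 1 := by rw [map_inv, hK, inv_one]
    have hKinvY : C.toLZ (h * B * h⁻¹ * B⁻¹)⁻¹ = 1 := by rw [map_inv, hKY, inv_one]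
    rw [hid, phi_commutator_conj_delta C hO hB hBY hBinv hKinv hKinvY, phi_commutator_inv C hB hK, zpow_neg, zpow_one]

variable (hS : D.Sec2Hyps) (α : (Pi C) ≃ₜ* (Pi C)) (τ : GQp p)
  (hgal : ∀ x : Pi C, aug C (α x) = τ * aug C x * τ⁻¹)
  (hYdd : ∀ x : Pi C, x ∈ PiYdd C ↔ α x ∈ PiYdd C)
  {d : ℤ} (hd1 : d = 1 ∨ d = -1) {y : Pi C} (hy : aug C y = 1) (hyY : C.toLZ y = 1) (hαB : α B = B ^ d * y)

include hO hB hd1 hy hyY in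
/-- Core computation: for `m ∈ Δ^tp_{Y̲̲}`, `φ[m, B^d y] = φ[m, B]^d` (`d = ±1`, `y ∈ Δ^tp_{Y̲̲}`). [cite: MochizukiEtTh2009, §1 p.12] -/
theorem phi_commutator_twist {m : Pi C} (hm : aug C m = 1) (hmY : C.toLZ m = 1) :
    phi C (m * (B ^ d * y) * m⁻¹ * (B ^ d * y)⁻¹) = (phi C (m * B * m⁻¹ * B⁻¹)) ^ d := by
  have hmy : phi C (m * y * m⁻¹ * y⁻¹) = 1 := phi_commutator_eq_one_of_origin C hO hm hmY hy hyY
  have hcm : phi C (m * B * m⁻¹ * B⁻¹) ∈ D.DeltaTheta := phi_commutator_mem_deltaTheta C hm hB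
  have hBΘ : phi C B ∈ D.DtpTheta := phi_mem_dtpTheta C hB
  rcases hd1 with rfl | rfl
  · have hid : m * (B ^ (1:ℤ) * y) * m⁻¹ * (B ^ (1:ℤ) * y)⁻¹ =
        (m * B * m⁻¹ * B⁻¹) * (B * (m * y * m⁻¹ * y⁻¹) * B⁻¹) := by group
    rw [hid, zpow_one, map_mul (phi C) (m * B * m⁻¹ * B⁻¹), map_mul (phi C) (B * (m * y * m⁻¹ * y⁻¹)) B⁻¹,
      map_mul (phi C) B (m * y * m⁻¹ * y⁻¹), hmy, mul_one, map_inv, mul_inv_cancel, mul_one]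
  · have hid : m * (B ^ (-1:ℤ) * y) * m⁻¹ * (B ^ (-1:ℤ) * y)⁻¹ =
        (B⁻¹ * (m * B * m⁻¹ * B⁻¹)⁻¹ * B) * (B⁻¹ * (m * y * m⁻¹ * y⁻¹) * B) := by group
    rw [hid, map_mul (phi C) (B⁻¹ * (m * B * m⁻¹ * B⁻¹)⁻¹ * B) (B⁻¹ * (m * y * m⁻¹ * y⁻¹) * B),
      map_mul (phi C) (B⁻¹ * (m * y * m⁻¹ * y⁻¹)) B, map_mul (phi C) B⁻¹ (m * y * m⁻¹ * y⁻¹), hmy, mul_one,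
      map_inv (phi C) B, inv_mul_cancel, mul_one, map_mul (phi C) (B⁻¹ * (m * B * m⁻¹ * B⁻¹)⁻¹) B,
      map_mul (phi C) B⁻¹ ((m * B * m⁻¹ * B⁻¹)⁻¹), map_inv (phi C) (m * B * m⁻¹ * B⁻¹), map_inv (phi C) B, zpow_neg,
      zpow_one]
    have hcomm : (phi C (m * B * m⁻¹ * B⁻¹))⁻¹ * phi C B = phi C B * (phi C (m * B * m⁻¹ * B⁻¹))⁻¹ :=
      D.deltaTheta_comm_dtpTheta (inv_mem hcm) hBΘ
    rw [mul_assoc, hcomm, ← mul_assoc, inv_mul_cancel, one_mul]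

include hO hS hgal hYdd hB hd1 hy hyY hαB in
/-- **`ᾱ(φ[n, B]) = φ[α n, B]^{d}`** for `n ∈ Δ^tp_{Y̲̲}`: the automorphism induced by `α` on `φ(Π^tp_{X̲̲})` acts on the
values of the commutator pairing through `α|_{Δ^tp_{Y̲̲}}` and the sign `d`. [cite: Mochizuki2012, Prop 3.4 (i) p.92] -/
theorem phi_alpha_commutator {n : Pi C} (hn : aug C n = 1) (hnY : C.toLZ n = 1) :
    phi C (α (n * B * n⁻¹ * B⁻¹)) = (phi C (α n * B * (α n)⁻¹ * B⁻¹)) ^ d := by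
  rw [map_mul α, map_mul α, map_mul α, map_inv α, map_inv α, hαB]
  exact phi_commutator_twist C hO hB hd1 hy hyY (aug_alpha_eq_one C α τ hgal hn) (toLZ_alpha_eq_one C hS α hYdd hnY)

include hO hB hBY hd1 hy hyY hαB in
/-- **The transported Kummer cocycle**: for ANY `g ∈ Π^tp_{X̲̲}` with `h := α g` and `k(x) := x B x⁻¹ B⁻¹`,
`φ[α(k g), B] = φ[k h, B]^d · (φ(h) φ[y, B] φ(h)⁻¹ · φ[y, B]⁻¹)`. [cite: Mochizuki2012, Prop 3.4 (i) p.92] -/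
theorem phi_commutator_alpha_kummer (g : Pi C) :
    phi C (α (g * B * g⁻¹ * B⁻¹) * B * (α (g * B * g⁻¹ * B⁻¹))⁻¹ * B⁻¹) =
      (phi C ((α g * B * (α g)⁻¹ * B⁻¹) * B * (α g * B * (α g)⁻¹ * B⁻¹)⁻¹ * B⁻¹)) ^ d *
        (phi C (α g) * phi C (y * B * y⁻¹ * B⁻¹) * (phi C (α g))⁻¹ * (phi C (y * B * y⁻¹ * B⁻¹))⁻¹) := by
  set h := α g with hh
  -- `α(k g) = F₁ · F₂` with `F₁ := h B^d h⁻¹ B^{-d}`, `F₂ := B^d (h y h⁻¹ y⁻¹) (B^d)⁻¹`, both in `Δ^tp_{Y̲̲}`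
  have hαk : α (g * B * g⁻¹ * B⁻¹) =
      (h * B ^ d * h⁻¹ * B ^ (-d)) * (B ^ d * (h * y * h⁻¹ * y⁻¹) * (B ^ d)⁻¹) := by
    rw [map_mul α, map_mul α, map_mul α, map_inv α, map_inv α, hαB, ← hh]; group
  have hF1 : aug C (h * B ^ d * h⁻¹ * B ^ (-d)) = 1 := by
    simp only [map_mul, map_inv, map_zpow, hB, one_zpow, mul_one, mul_inv_cancel]
  have hc2 : aug C (h * y * h⁻¹ * y⁻¹) = 1 := by
    simp only [map_mul, map_inv, hy, inv_one, mul_one, mul_inv_cancel]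
  have hc2Y : C.toLZ (h * y * h⁻¹ * y⁻¹) = 1 := by
    simp only [map_mul, map_inv, hyY, inv_one, mul_one, mul_inv_cancel]
  have hBd : aug C (B ^ d) = 1 := by rw [map_zpow, hB, one_zpow]
  have hF2 : aug C (B ^ d * (h * y * h⁻¹ * y⁻¹) * (B ^ d)⁻¹) = 1 := by
    rw [map_mul, map_mul, map_inv, hBd, hc2, mul_one, one_mul, inv_one]
  rw [hαk, phi_commutator_mul C hB hF1 hF2, phi_commutator_sign C hO hB hBY h hd1,
    phi_commutator_conj_delta C hO hB hBY hBd hc2 hc2Y, phi_commutator_hconj C hO hB hBY h hy hyY]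

include hO hS hgal hYdd hB hBY hd1 hy hyY hαB in
/-- **THE `q`-KUMMER RELATION IN `(Π^tp_X)^Θ`** (group theory of [EtTh] §1; the tempered sign used as `d² = 1`): for every
`g ∈ Π^tp_{X̲̲}`, with `k(g) := g B g⁻¹ B⁻¹ ∈ Δ^tp_{Y̲̲}` (the Kummer cocycle of the `Z`-generator `B`),
`ᾱ(φ[k g, B]) := φ(α [k g, B]) = φ[k(α g), B] · (φ(α g) φ[y, B] φ(α g)⁻¹ · φ[y, B]⁻¹)^d`.
[cite: Mochizuki2012, Prop 3.4 (i) p.92] -/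
theorem phi_alpha_kummer (g : Pi C) :
    phi C (α ((g * B * g⁻¹ * B⁻¹) * B * (g * B * g⁻¹ * B⁻¹)⁻¹ * B⁻¹)) =
      phi C ((α g * B * (α g)⁻¹ * B⁻¹) * B * (α g * B * (α g)⁻¹ * B⁻¹)⁻¹ * B⁻¹) *
        (phi C (α g) * phi C (y * B * y⁻¹ * B⁻¹) * (phi C (α g))⁻¹ * (phi C (y * B * y⁻¹ * B⁻¹))⁻¹) ^ d := by
  have hk : aug C (g * B * g⁻¹ * B⁻¹) = 1 := by
    simp only [map_mul, map_inv, hB, inv_one, mul_one, mul_inv_cancel]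
  have hkY : C.toLZ (g * B * g⁻¹ * B⁻¹) = 1 := by
    apply toLZ_eq_one_of_toAdd C
    simp only [map_mul, map_inv, hBY, toAdd_mul, toAdd_inv, toAdd_ofAdd]; ring
  rw [phi_alpha_commutator C hO hB hS α τ hgal hYdd hd1 hy hyY hαB hk hkY,
    phi_commutator_alpha_kummer C hO hB hBY α hd1 hy hyY hαB g]
  -- `(a^d · t)^d = a · t^d` for commuting `a, t ∈ Δ_Θ` and `d = ±1`
  set a := phi C ((α g * B * (α g)⁻¹ * B⁻¹) * B * (α g * B * (α g)⁻¹ * B⁻¹)⁻¹ * B⁻¹) with ha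
  set t := phi C (α g) * phi C (y * B * y⁻¹ * B⁻¹) * (phi C (α g))⁻¹ * (phi C (y * B * y⁻¹ * B⁻¹))⁻¹ with ht
  have haΘ : a ∈ D.DeltaTheta := by
    have hK : aug C (α g * B * (α g)⁻¹ * B⁻¹) = 1 := by
      simp only [map_mul, map_inv, hB, inv_one, mul_one, mul_inv_cancel]
    exact phi_commutator_mem_deltaTheta C hK hB
  have htΘ : t ∈ D.DeltaTheta := by
    have hcy : phi C (y * B * y⁻¹ * B⁻¹) ∈ D.DeltaTheta := phi_commutator_mem_deltaTheta C hy hB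
    have h1 : phi C (α g) * phi C (y * B * y⁻¹ * B⁻¹) * (phi C (α g))⁻¹ ∈ D.DeltaTheta :=
      (inferInstanceAs D.thetaToEll.ker.Normal : D.DeltaTheta.Normal).conj_mem _ hcy _
    exact mul_mem h1 (inv_mem hcy)
  have hcomm : Commute a t := D.ker_thetaToEll_comm a haΘ t htΘ
  rcases hd1 with rfl | rfl
  · rw [zpow_one, zpow_one, zpow_one]
  · rw [zpow_neg, zpow_one, zpow_neg, zpow_one, zpow_neg, zpow_one, mul_inv_rev, inv_inv]
    exact hcomm.symm.inv_left.eq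

end Transport

end EtaleThetaDataOfSetting

end Literature.IUT.HodgeArakelov

end
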